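import Literature.Barriers.BirchSwinnertonDyer.PAdicFunctionalEquationParityLambdaTwoProofs
import Literature.NumberTheory.EllipticCurves.Sprung2017.SharpFlatPAdicLFunctionTwoProofs
import Literature.NumberTheory.EllipticCurves.Sprung2017.SharpFlatPAdicLFunctionUniqueProofs
import HarnessLib

/-!
# The functional equation of Sprung's pair `(L♯₂, L♭₂)` at a supersingular `2` with `a₂ = 0`
# (proofs only)

A *proofs* companion (theorems only; no definition, no named fact) of
`PAdicFunctionalEquationParity…` and of `Sprung2017/SharpFlatPAdicLFunction{,Two,Unique}Proofs`.
For an elliptic curve `E = W/ℚ` (globally minimal model) with newform `f ∈ S₂(Γ₀(N))`, good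
SUPERSINGULAR reduction at `2` and `a₂(E) = 0`, the tree has Sprung's pair
`(L♯, L♭) ∈ Λ² = ℤ₂⟦T⟧²` (`exists_isSprungPair_two`: the Mazur–Tate elements satisfy
`θ_n(T) ≡ −(u_n L♯ + v_n L♭) (mod ω_n)`, `ω_n = (1+T)^{2ⁿ} − 1`, `u_n, v_n` the chromatic
polynomials `sharpPoly 0 2 n`, `flatPoly 0 2 n`) and its uniqueness (`IsSprungPair.unique`). The
measure-level functional equation of the tree (`padicLFunction`, unit root `α`) is not available at a
supersingular prime. This file proves the functional equations of `L♯` and `L♭` directly in `Λ`: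

  `L♯(T^ι) = σ (1+T)^{c+a} L♯(T)`, `L♭(T^ι) = σ (1+T)^{c+b} L♭(T)`, `T^ι = (1+T)⁻¹ − 1`,

(`subst_invOnePlusSubOne_eq_of_isSprungPair_two`; read in `ℚ₂⟦T⟧`:
`subst_iwasawaToPowerSeries_eq_of_isSprungPair_two`; packaged: `exists_functionalEquation_sharp_flat_two`;
at the conductor level with `σ = w_E = W.rootNumber`:
`subst_invOnePlusSubOne_eq_rootNumber_of_isSprungPair_two`), where `w_N f = −σ f` (`σ = ±1`),
`N = η_N 5^c` in `ℤ₂^× = μ₄ × 5^{ℤ₂}` (`c ∈ ℤ₂`), and `a = −2/3`, `b = −1/3 ∈ ℤ₂` (`3a = −2`,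
`3b = −1`). This is the `p = 2`, `i = 0` case of Sprung's explicit functional equation for the
non-completed `L♯/L♭` when `a_p = 0` [Sprung2017, Cor. 4.14 and §3.5]: there the correcting units are
`W⁺(1+T) = ∏_{j ≥ 1}(1+T)^{−2^{2j−1}} = (1+T)^{2/3}` and, for `p = 2`,
`W⁻(1+T) = (1+T)^{−1}∏_{j ≥ 2}(1+T)^{−2^{2j−2}} = (1+T)^{1/3}` (as `ℤ₂`-powers), i.e. the shifts
`a`, `b` of the exponent after the substitution `T ↦ T^ι` (signs as normalised in the tree:
`σ = −ε(f) = w_E`, Greenberg §1; Sprung writes `f^* = −c_N f`).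

## Proof

Not Sprung's (who passes through the completed `L̂♯, L̂♭` and the matrix `Log_{α,β}`), but the
finite-level route, which needs no `p`-adic analysis:
* §4 the functional equation of the Mazur–Tate elements at finite level
  (`exists_two_mul_mazurTateElement_fe`): from the Fricke symmetry of the raw modular symbols
  `[−a♭/(2ⁿ⁺²N)]⁺ = −σ[a/2ⁿ⁺²]⁺`, `a a♭ N ≡ 1` (tree: `IsFrickeEigen.normalizedPlusSymbol_div_eq_mul`,
  `finsum_sum_classes_eq_mul_of_symmetry`), `2θ_n(T^ι) ≡ 2σ(1+T)^{c_n}θ_n(T) (mod ω_n)` in `Λ`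
  (`c_n = c mod 2ⁿ`; the factor `2` makes the symbols integral, `‖[a/2^k]⁺‖₂ ≤ 2`) — this is
  [MazurTateTeitelbaum1986Invent, §I.17] at finite level;
* §2–§3 the behaviour of the other players under `ι`: `ω_n(T^ι) = −E^{2ⁿ}ω_n` with
  `E = 1 + T^ι = (1+T)⁻¹`, and the HOMOGENEITY of the chromatic polynomials at `a₂ = 0`:
  `u_n(T^ι) = E^{⌊2ⁿ/3⌋}u_n`, `v_n(T^ι) = E^{⌊2ⁿ/3⌋}v_n` (from `x_n(T^ι) = E^{⌊2ⁿ/3⌋}x_n` for the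
  Sprung sequence `x_{n+2} = −Φ_{2^{n+2}}(1+T)x_n`, `Φ_{2^k}(1+T^ι) = E^{2^{k−1}}Φ_{2^k}(1+T)`), with
  `u_{2k} = 0`, `v_{2k+1} = 0`;
* §1, §5 binomial series with `ℤ₂`-exponents modulo `ω_n`: `(1+T)^x ≡ (1+T)^j (mod ω_n)` when
  `x ≡ j (mod 2ⁿ)` (Mahler continuity of `x ↦ (1+T)^x mod (T^{e}, ω_n)` and density of `ℕ`), and
  `−2/3 ≡ ⌊2ⁿ/3⌋ (mod 2ⁿ)` for odd `n`, `−1/3 ≡ ⌊2ⁿ/3⌋ (mod 2ⁿ)` for even `n`;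
* §6 transport: `(σ(1+T)^{−(c+a)}L♯(T^ι), σ(1+T)^{−(c+b)}L♭(T^ι))` is again a Sprung pair
  (`isSprungPair_two_zero_transport`, one `linear_combination` over `ℚ₂⟦T⟧` modulo `ω_n`);
* §7 uniqueness of the pair (`IsSprungPair.unique`, [Sprung2017, Thm. 1.12]) and `σ² = 1`,
  `(1+T)^x(1+T)^{−x} = 1`.

Requested by the residual cell `b2b-bsdres`, class O1 (X5, `p = 2` non-CM), o1 lead typer queue
v3.4a item (23) "PARITY(2) at `a₂ = 0`" (R-G17.6 / lens-1 R-L1-G6-B): the parity consequences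
(`λ♯`, `λ♭` modulo `2` versus `N mod 8`) are read off these functional equations with
`norm_natCast_sub_le_of_subst_invOnePlusSubOne_eq` in the sibling file
`PAdicFunctionalEquationParityLambdaSharpFlatTwoProofs`.

## References

* F. Sprung, *On pairs of `p`-adic `L`-functions for weight-two modular forms*, Algebra & Number
  Theory 11 (2017), Thm. 1.12 and Cor. 4.4 (the pair, all good `p` incl. `p = 2`), §3.4–§3.5
  (Prop. 3.14, the units `W^±`), Cor. 4.14 (functional equation; explicit form when `a_p = 0`).
  [Sprung2017]
* B. Mazur, J. Tate, J. Teitelbaum, *On `p`-adic analogues of the conjectures of Birch and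
  Swinnerton-Dyer*, Invent. Math. 84 (1986), §I.13 (Mazur–Tate elements), §I.17 (functional
  equation). [MazurTateTeitelbaum1986Invent]
* R. Greenberg, *Iwasawa theory for elliptic curves*, LNM 1716 (1999), §1 (pp. 67–68:
  `L_p(E/ℚ, 2−s) = w_E⟨N_E⟩^{s−1}L_p(E/ℚ, s)`, the sign is the root number). [GreenbergLNM1716]
-/

noncomputable section

open scoped MatrixGroups ModularForm

open CongruenceSubgroup PowerSeries Filter Topology
  Literature.NumberTheory.EllipticCurves Literature.NumberTheory.EllipticCurves.ModularForms
  Literature.NumberTheory.EllipticCurves.Sprung2017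

namespace Literature.Barriers.BirchSwinnertonDyer

/-! ## §1. Binomial series with `p`-adic exponents modulo `ω_n = (1+T)^{pⁿ} − 1` -/

section Binomial

variable {p : ℕ} [Fact p.Prime]

/-- The coefficient of `T^e` in `G((1+T)^k − 1)`-type substitutions is a FINITE sum: for `ω` with
`ω(0) = 0`, `[T^e] G(ω) = Σ_{d ≤ e} [T^d]G · [T^e]ω^d`. [folklore] -/
private theorem coeff_subst_eq_sum_range {R : Type*} [CommRing R] {ω : R⟦X⟧} (hω : constantCoeff ω = 0)
    (G : R⟦X⟧) (e : ℕ) :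
    coeff e (G.subst ω) = ∑ d ∈ Finset.range (e + 1), coeff d G * coeff e (ω ^ d) := by
  rw [coeff_subst' (HasSubst.of_constantCoeff_zero' hω),
    finsum_eq_sum_of_support_subset _ (s := Finset.range (e + 1)) ?_]
  · simp only [smul_eq_mul]
  · intro d hd
    simp only [Function.mem_support, ne_eq, Finset.coe_range, Set.mem_Iio] at hd ⊢
    by_contra hlt
    apply hd
    rw [coeff_of_lt_order e (lt_of_lt_of_le (by exact_mod_cast (by omega : e < d))
      (natCast_le_order_pow hω d)), smul_zero]

/-- **`(1+T)^{k·y} = ((1+T)^k)^y`** for a `p`-adic exponent `y ∈ ℤ_p` and `k ∈ ℕ`: the binomial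
series of exponent `k·y` is the binomial series of exponent `y` evaluated at `(1+T)^k − 1`. Both
sides have coefficients CONTINUOUS in `y` (Mahler: `y ↦ (y choose d)` is continuous on `ℤ_p`) and
agree for `y ∈ ℕ` (dense in `ℤ_p`), where both are `(1+T)^{ky}`. [folklore] -/
private theorem binomialSeries_natCast_mul_eq_subst (k : ℕ) (y : ℤ_[p]) :
    PowerSeries.binomialSeries ℤ_[p] ((k : ℤ_[p]) * y) =
      (PowerSeries.binomialSeries ℤ_[p] y).subst ((1 + X : ℤ_[p]⟦X⟧) ^ k - 1) := by
  set ω : ℤ_[p]⟦X⟧ := (1 + X) ^ k - 1 with hωdef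
  have hω : constantCoeff ω = 0 := by simp [hωdef]
  have hωs : HasSubst ω := HasSubst.of_constantCoeff_zero' hω
  ext e
  suffices h : (fun z : ℤ_[p] ↦ coeff e (PowerSeries.binomialSeries ℤ_[p] ((k : ℤ_[p]) * z))) =
      fun z ↦ coeff e ((PowerSeries.binomialSeries ℤ_[p] z).subst ω) from congrFun h y
  apply Continuous.ext_on PadicInt.denseRange_natCast
  · simp only [binomialSeries_coeff, smul_eq_mul, mul_one]
    exact (PadicInt.continuous_choose e).comp (continuous_const.mul continuous_id)
  · have hform : (fun z : ℤ_[p] ↦ coeff e ((PowerSeries.binomialSeries ℤ_[p] z).subst ω)) =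
        fun z ↦ ∑ d ∈ Finset.range (e + 1), Ring.choose z d * coeff e (ω ^ d) := by
      funext z
      rw [coeff_subst_eq_sum_range hω]
      simp only [binomialSeries_coeff, smul_eq_mul, mul_one]
    rw [hform]
    exact continuous_finsetSum _ fun d _ ↦ (PadicInt.continuous_choose d).mul continuous_const
  · rintro _ ⟨m, rfl⟩
    have h1 : ((k : ℤ_[p]) * (m : ℤ_[p])) = ((k * m : ℕ) : ℤ_[p]) := by push_cast; ring
    have hone : (1 : ℤ_[p]⟦X⟧).subst ω = 1 := by
      rw [← coe_substAlgHom hωs, map_one]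
    simp only
    rw [h1, binomialSeries_nat, binomialSeries_nat, subst_pow hωs, subst_add hωs, hone,
      subst_X hωs, pow_mul, hωdef, add_sub_cancel]

/-- **`(1+T)^{pⁿy} ≡ 1 (mod ω_n)`** in `Λ = ℤ_p⟦T⟧` for every `p`-adic exponent `y`:
`(1+T)^{pⁿ y} − 1 = G(ω_n) − 1` with `G = (1+T)^y = 1 + T·H`, `ω_n = (1+T)^{pⁿ} − 1`.
[folklore] -/
private theorem exists_binomialSeries_pow_mul_sub_one_eq (n : ℕ) (y : ℤ_[p]) :
    ∃ q : ℤ_[p]⟦X⟧, PowerSeries.binomialSeries ℤ_[p] (((p ^ n : ℕ) : ℤ_[p]) * y) - 1 =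
      ((1 + X : ℤ_[p]⟦X⟧) ^ (p ^ n) - 1) * q := by
  set ω : ℤ_[p]⟦X⟧ := (1 + X) ^ (p ^ n) - 1 with hωdef
  have hω : constantCoeff ω = 0 := by simp [hωdef]
  have hωs : HasSubst ω := HasSubst.of_constantCoeff_zero' hω
  -- `G = 1 + X · H`
  set G : ℤ_[p]⟦X⟧ := PowerSeries.binomialSeries ℤ_[p] y with hG
  have hG1 : constantCoeff G = 1 := binomialSeries_constantCoeff y
  obtain ⟨H, hH⟩ : ∃ H : ℤ_[p]⟦X⟧, G - 1 = X * H := by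
    refine ⟨PowerSeries.mk fun i ↦ coeff (i + 1) (G - 1), ?_⟩
    ext i
    rcases i with _ | i
    · simp [coeff_zero_eq_constantCoeff_apply, hG1]
    · rw [coeff_succ_X_mul, coeff_mk]
  refine ⟨H.subst ω, ?_⟩
  rw [binomialSeries_natCast_mul_eq_subst, ← hωdef, ← hG]
  have hGe : G = 1 + X * H := by rw [← hH]; ring
  have hone : (1 : ℤ_[p]⟦X⟧).subst ω = 1 := by rw [← coe_substAlgHom hωs, map_one]
  conv_lhs => rw [hGe, subst_add hωs, hone, subst_mul hωs, subst_X hωs]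
  ring

/-- **`(1+T)^x ≡ (1+T)^m (mod ω_n)`** in `Λ` whenever the `p`-adic exponent `x` is congruent to the
natural number `m` modulo `pⁿ` (`toZModPow n x = m`). [folklore] -/
private theorem exists_binomialSeries_sub_pow_eq {n : ℕ} {x : ℤ_[p]} {m : ℕ}
    (hx : PadicInt.toZModPow n x = (m : ZMod (p ^ n))) :
    ∃ q : ℤ_[p]⟦X⟧, PowerSeries.binomialSeries ℤ_[p] x - (1 + X : ℤ_[p]⟦X⟧) ^ m =
      ((1 + X : ℤ_[p]⟦X⟧) ^ (p ^ n) - 1) * q := by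
  have hker : x - (m : ℤ_[p]) ∈ RingHom.ker (PadicInt.toZModPow (p := p) n) := by
    rw [RingHom.mem_ker, map_sub, map_natCast, hx, sub_self]
  rw [PadicInt.ker_toZModPow, Ideal.mem_span_singleton] at hker
  obtain ⟨y, hy⟩ := hker
  obtain ⟨q, hq⟩ := exists_binomialSeries_pow_mul_sub_one_eq n y
  refine ⟨(1 + X : ℤ_[p]⟦X⟧) ^ m * q, ?_⟩
  have hx' : x = (m : ℤ_[p]) + ((p ^ n : ℕ) : ℤ_[p]) * y := by
    push_cast; linear_combination hy
  rw [hx', binomialSeries_add, binomialSeries_nat]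
  linear_combination ((1 + X : ℤ_[p]⟦X⟧) ^ m) * hq

end Binomial

/-! ## §2. The involution `ι` on `Λ`: `E = 1 + ι = (1+T)⁻¹`, `ι(ω_n)`, homogeneity at `p = 2` -/

section Iota

variable {R : Type*} [CommRing R]

/-- `E := 1 + ι = (1+T)⁻¹`: `(1 + T) · E = 1`. [folklore] -/
private theorem one_add_X_mul_E : (1 + X : R⟦X⟧) * (invOnePlusSubOne + 1) = 1 :=
  one_add_X_mul_invOnePlusSubOne_add_one

/-- `(1+T)^k · E^k = 1`. [folklore] -/
private theorem one_add_X_pow_mul_E_pow (k : ℕ) :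
    (1 + X : R⟦X⟧) ^ k * (invOnePlusSubOne + 1) ^ k = 1 := by
  rw [← mul_pow, one_add_X_mul_E, one_pow]

/-- `ι(1 + T) = E`: substituting `ι` into `1 + T` gives `1 + ι = (1+T)⁻¹`. [folklore] -/
private theorem subst_invOnePlusSubOne_one_add_X :
    (1 + X : R⟦X⟧).subst (invOnePlusSubOne : R⟦X⟧) = invOnePlusSubOne + 1 := by
  have hι := hasSubst_invOnePlusSubOne (R := R)
  rw [subst_add hι, subst_X hι, ← coe_substAlgHom hι, map_one, add_comm]

/-- `ι((1+T)^k) = E^k`. [folklore] -/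
private theorem subst_invOnePlusSubOne_one_add_X_pow (k : ℕ) :
    ((1 + X : R⟦X⟧) ^ k).subst (invOnePlusSubOne : R⟦X⟧) = (invOnePlusSubOne + 1) ^ k := by
  rw [subst_pow hasSubst_invOnePlusSubOne, subst_invOnePlusSubOne_one_add_X]

/-- **`ι(ω_n) = −E^{pⁿ} · ω_n`** for `ω_n = (1+T)^{pⁿ} − 1`: the ideal `(ω_n)` is `ι`-stable.
[folklore] -/
private theorem subst_invOnePlusSubOne_omega (q : ℕ) :
    ((1 + X : R⟦X⟧) ^ q - 1).subst (invOnePlusSubOne : R⟦X⟧) =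
      -(invOnePlusSubOne + 1) ^ q * ((1 + X : R⟦X⟧) ^ q - 1) := by
  have hι := hasSubst_invOnePlusSubOne (R := R)
  rw [subst_sub hι, subst_invOnePlusSubOne_one_add_X_pow, ← coe_substAlgHom hι, map_one]
  linear_combination (one_add_X_pow_mul_E_pow (R := R) q)

/-- **`ι`-homogeneity of `Φ_{2^{j+1}}(1+T) = (1+T)^{2^j} + 1`** (the `p = 2` phenomenon):
`ι((1+T)^{m} + 1) = E^{m} · ((1+T)^{m} + 1)`. [folklore] -/
private theorem subst_invOnePlusSubOne_one_add_X_pow_add_one (m : ℕ) :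
    ((1 + X : R⟦X⟧) ^ m + 1).subst (invOnePlusSubOne : R⟦X⟧) =
      (invOnePlusSubOne + 1) ^ m * ((1 + X : R⟦X⟧) ^ m + 1) := by
  have hι := hasSubst_invOnePlusSubOne (R := R)
  rw [subst_add hι, subst_invOnePlusSubOne_one_add_X_pow, ← coe_substAlgHom hι, map_one]
  linear_combination (-(one_add_X_pow_mul_E_pow (R := R) m))

end Iota

/-! ## §3. `ι`-homogeneity of Sprung's recursion polynomials at `p = 2`, `a₂ = 0` -/

section Homogeneity

variable {R : Type*} [CommRing R]

/-- `Φ_{2^{n+1}}(1+T) = (1+T)^{2ⁿ} + 1` as a power series over `R`. [folklore] -/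
private theorem coe_map_cyclotomic_two_pow_comp (n : ℕ) :
    ((((Polynomial.cyclotomic (2 ^ (n + 1)) ℤ).comp (Polynomial.X + 1)).map (Int.castRingHom R) :
      Polynomial R) : R⟦X⟧) = (1 + X : R⟦X⟧) ^ (2 ^ n) + 1 := by
  rw [Polynomial.cyclotomic_prime_pow_eq_geom_sum Nat.prime_two, Finset.sum_range_succ,
    Finset.sum_range_one, pow_zero, pow_one]
  simp only [Polynomial.add_comp, Polynomial.one_comp, Polynomial.pow_comp, Polynomial.X_comp,
    Polynomial.map_add, Polynomial.map_one, Polynomial.map_pow, Polynomial.map_X,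
    Polynomial.coe_add, Polynomial.coe_one, Polynomial.coe_pow, Polynomial.coe_X]
  ring

/-- Sprung's recursion at `a_p = 0`, `p = 2`, for power series over `R`:
`x_{n+2} = −((1+T)^{2ⁿ} + 1)·x_n`. [cite: Sprung2017, §4 Cor. 4.4] -/
theorem coe_map_sprungSeq_zero_two_add_two (x₀ x₁ : Polynomial ℤ) (n : ℕ) :
    (((sprungSeq 0 2 x₀ x₁ (n + 2)).map (Int.castRingHom R) : Polynomial R) : R⟦X⟧) =
      -(((1 + X : R⟦X⟧) ^ (2 ^ n) + 1) *
        (((sprungSeq 0 2 x₀ x₁ n).map (Int.castRingHom R) : Polynomial R) : R⟦X⟧)) := by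
  rw [sprungSeq_add_two, Polynomial.C_0, zero_mul, zero_sub, Polynomial.map_neg,
    Polynomial.map_mul, Polynomial.coe_neg, Polynomial.coe_mul, coe_map_cyclotomic_two_pow_comp]

/-- `2^{n+2}/3 = 2ⁿ + 2ⁿ/3` (the exponents `e_n = ⌊2ⁿ/3⌋`: `0, 0, 1, 2, 5, 10, 21, …`). [folklore] -/
private theorem two_pow_add_two_div_three (n : ℕ) : 2 ^ (n + 2) / 3 = 2 ^ n + 2 ^ n / 3 := by
  have h : 2 ^ (n + 2) = 2 ^ n + 3 * 2 ^ n := by ring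
  rw [h, Nat.add_mul_div_left _ _ (by norm_num : 0 < 3), add_comm]

/-- **`ι`-homogeneity of a Sprung sequence with constant seeds** (`a_p = 0`, `p = 2`): if
`x₀ = C c₀`, `x₁ = C c₁`, then `x_n(T^ι) = E^{⌊2ⁿ/3⌋} · x_n(T)` with `E = (1+T)⁻¹`, for every `n`
(each step multiplies by `−Φ_{2^{n+1}}(1+T)`, homogeneous of weight `2ⁿ`). [folklore] -/
private theorem subst_invOnePlusSubOne_sprungSeq_zero_two (c₀ c₁ : ℤ) (n : ℕ) :
    ((((sprungSeq 0 2 (Polynomial.C c₀) (Polynomial.C c₁) n).map (Int.castRingHom R) :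
        Polynomial R) : R⟦X⟧)).subst (invOnePlusSubOne : R⟦X⟧) =
      (invOnePlusSubOne + 1) ^ (2 ^ n / 3) *
        (((sprungSeq 0 2 (Polynomial.C c₀) (Polynomial.C c₁) n).map (Int.castRingHom R) :
          Polynomial R) : R⟦X⟧) := by
  have hι := hasSubst_invOnePlusSubOne (R := R)
  have hC : ∀ c : ℤ, ((((Polynomial.C c).map (Int.castRingHom R) : Polynomial R) : R⟦X⟧)).subst
      (invOnePlusSubOne : R⟦X⟧) = (((Polynomial.C c).map (Int.castRingHom R) : Polynomial R) :
        R⟦X⟧) := by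
    intro c
    rw [Polynomial.map_C, Polynomial.coe_C, ← coe_substAlgHom hι, C_eq_algebraMap,
      AlgHom.commutes]
  induction n using Nat.strong_induction_on with
  | _ n ih =>
    match n with
    | 0 =>
      rw [sprungSeq_zero, hC, show 2 ^ 0 / 3 = 0 from rfl, pow_zero, one_mul]
    | 1 =>
      rw [sprungSeq_one, hC, show 2 ^ 1 / 3 = 0 from rfl, pow_zero, one_mul]
    | n + 2 =>
      rw [coe_map_sprungSeq_zero_two_add_two, ← coe_substAlgHom hι, map_neg, map_mul,
        coe_substAlgHom hι, subst_invOnePlusSubOne_one_add_X_pow_add_one, ih n (by omega),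
        two_pow_add_two_div_three, pow_add]
      ring

/-- `u_n(T^ι) = E^{⌊2ⁿ/3⌋} u_n(T)` for `u_n = sharpPoly 0 2 n`. [cite: Sprung2017, §4 Cor. 4.4] -/
theorem subst_invOnePlusSubOne_sharpPoly_zero_two (n : ℕ) :
    ((((sharpPoly 0 2 n).map (Int.castRingHom R) : Polynomial R) : R⟦X⟧)).subst
        (invOnePlusSubOne : R⟦X⟧) =
      (invOnePlusSubOne + 1) ^ (2 ^ n / 3) *
        (((sharpPoly 0 2 n).map (Int.castRingHom R) : Polynomial R) : R⟦X⟧) := by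
  have h := subst_invOnePlusSubOne_sprungSeq_zero_two (R := R) 0 1 n
  simpa only [sharpPoly, map_zero, map_one] using h

/-- `v_n(T^ι) = E^{⌊2ⁿ/3⌋} v_n(T)` for `v_n = flatPoly 0 2 n`. [cite: Sprung2017, §4 Cor. 4.4] -/
theorem subst_invOnePlusSubOne_flatPoly_zero_two (n : ℕ) :
    ((((flatPoly 0 2 n).map (Int.castRingHom R) : Polynomial R) : R⟦X⟧)).subst
        (invOnePlusSubOne : R⟦X⟧) =
      (invOnePlusSubOne + 1) ^ (2 ^ n / 3) *
        (((flatPoly 0 2 n).map (Int.castRingHom R) : Polynomial R) : R⟦X⟧) := by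
  have h := subst_invOnePlusSubOne_sprungSeq_zero_two (R := R) 1 0 n
  simpa only [flatPoly, map_zero, map_one] using h

/-- At `a_p = 0`: `x_n = 0` propagates two steps (`x_{n+2} = −Φ·x_n`). [folklore] -/
private theorem sprungSeq_zero_eq_zero_of_eq_zero {p : ℕ} (x₀ x₁ : Polynomial ℤ) {n : ℕ}
    (h : sprungSeq 0 p x₀ x₁ n = 0) : sprungSeq 0 p x₀ x₁ (n + 2) = 0 := by
  rw [sprungSeq_add_two, h, Polynomial.C_0, zero_mul, mul_zero, sub_zero]

/-- `u_{2k} = 0` at `a_p = 0`. [cite: Sprung2017, §4 (the case a_p = 0)] -/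
theorem sharpPoly_zero_two_mul (p k : ℕ) : sharpPoly 0 p (2 * k) = 0 := by
  induction k with
  | zero => rfl
  | succ k ih =>
    rw [show 2 * (k + 1) = 2 * k + 2 by ring]
    exact sprungSeq_zero_eq_zero_of_eq_zero 0 1 ih

/-- `v_{2k+1} = 0` at `a_p = 0`. [cite: Sprung2017, §4 (the case a_p = 0)] -/
theorem flatPoly_zero_two_mul_add_one (p k : ℕ) : flatPoly 0 p (2 * k + 1) = 0 := by
  induction k with
  | zero => rfl
  | succ k ih =>
    rw [show 2 * (k + 1) + 1 = (2 * k + 1) + 2 by ring]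
    exact sprungSeq_zero_eq_zero_of_eq_zero 1 0 ih

end Homogeneity

/-! ## §4. The finite-level functional equation of the Mazur–Tate element at `2` -/

section FiniteLevel

/-- `ι` has integer coefficients: it is fixed by any coefficient map. [folklore] -/
private theorem map_invOnePlusSubOne {R S : Type*} [CommRing R] [CommRing S] (φ : R →+* S) :
    PowerSeries.map φ (invOnePlusSubOne : R⟦X⟧) = invOnePlusSubOne := by
  ext n
  simp only [coeff_map, coeff_invOnePlusSubOne]
  split_ifs <;> simp

/-- `ι_Λ ∘ S = S ∘ ι_Λ`: the coefficient embedding `Λ = ℤ_p⟦T⟧ ↪ ℚ_p⟦T⟧` commutes with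
`g ↦ g(T^ι)`. [folklore] -/
private theorem iwasawaToPowerSeries_subst_invOnePlusSubOne {p : ℕ} [Fact p.Prime]
    (g : IwasawaAlgebra p) :
    iwasawaToPowerSeries p (g.subst (invOnePlusSubOne : ℤ_[p]⟦X⟧)) =
      (iwasawaToPowerSeries p g).subst (invOnePlusSubOne : ℚ_[p]⟦X⟧) := by
  have h := map_subst (hasSubst_invOnePlusSubOne (R := ℤ_[p])) (h := algebraMap ℤ_[p] ℚ_[p]) g
  have hι : MvPowerSeries.map (algebraMap ℤ_[p] ℚ_[p]) (invOnePlusSubOne : ℤ_[p]⟦X⟧) =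
      (invOnePlusSubOne : ℚ_[p]⟦X⟧) := map_invOnePlusSubOne _
  rw [hι] at h
  exact h

/-- `ω_n = (1+T)^{pⁿ} − 1` as a power series over `ℤ_p`. [folklore] -/
private theorem coe_map_cyclotomicOmega {p : ℕ} [Fact p.Prime] (n : ℕ) :
    (((cyclotomicOmega p n).map (Int.castRingHom ℤ_[p]) : Polynomial ℤ_[p]) : ℤ_[p]⟦X⟧) =
      (1 + X : ℤ_[p]⟦X⟧) ^ (p ^ n) - 1 := by
  simp only [cyclotomicOmega, Polynomial.map_sub, Polynomial.map_pow, Polynomial.map_add,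
    Polynomial.map_X, Polynomial.map_one, Polynomial.coe_sub, Polynomial.coe_pow,
    Polynomial.coe_add, Polynomial.coe_X, Polynomial.coe_one, add_comm]

/-- Coercion `R[T] → R⟦T⟧` of a finite sum. [folklore] -/
private theorem coe_polynomial_sum {R : Type*} [CommSemiring R] {ι : Type*} (t : Finset ι)
    (q : ι → Polynomial R) :
    (((∑ i ∈ t, q i : Polynomial R)) : R⟦X⟧) = ∑ i ∈ t, ((q i : Polynomial R) : R⟦X⟧) :=
  map_sum (Polynomial.coeToPowerSeries.ringHom (R := R)) q t

variable {N : ℕ} [NeZero N] {f : CuspForm (Gamma0 N) 2}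

omit [NeZero N] in
/-- The Mazur–Tate element at `2`, mapped to `ℚ₂⟦T⟧`, as its class sum. [folklore] -/
private theorem coe_map_mazurTateElement_two (n : ℕ) :
    ((((mazurTateElement f 2 n).map (algebraMap ℚ ℚ_[2])) : Polynomial ℚ_[2]) : ℚ_[2]⟦X⟧) =
      ∑ᶠ ξ : rootsOfUnity (torsionOrder 2) ℤ_[2], ∑ s : ZMod (2 ^ n),
        PowerSeries.C (((ratPlusSymbol f
          (((PadicInt.toZModPow (n + cyclotomicExponent 2) ((ξ : ℤ_[2]ˣ) : ℤ_[2]) *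
              (cyclotomicGenerator 2 : ZMod (2 ^ (n + cyclotomicExponent 2))) ^ s.val).val : ℚ) /
            (2 : ℚ) ^ (n + cyclotomicExponent 2)) : ℚ) : ℚ_[2])) *
          (1 + X : ℚ_[2]⟦X⟧) ^ s.val := by
  classical
  haveI := neZero_torsionOrder 2
  haveI : Fintype (rootsOfUnity (torsionOrder 2) ℤ_[2]) := Fintype.ofFinite _
  rw [mazurTateElement, finsum_eq_sum_of_fintype, finsum_eq_sum_of_fintype, Polynomial.map_sum,
    coe_polynomial_sum]
  refine Finset.sum_congr rfl fun ξ _ ↦ ?_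
  rw [Polynomial.map_sum, coe_polynomial_sum]
  refine Finset.sum_congr rfl fun s _ ↦ ?_
  rw [Polynomial.map_mul, Polynomial.map_pow, Polynomial.map_add, Polynomial.map_X,
    Polynomial.map_one, Polynomial.map_C, Polynomial.coe_mul, Polynomial.coe_pow,
    Polynomial.coe_add, Polynomial.coe_X, Polynomial.coe_one, Polynomial.coe_C, eq_ratCast,
    add_comm (X : ℚ_[2]⟦X⟧) 1]
  norm_num

/-- **The doubled symbols are `2`-adic integers** at a good supersingular `2`: `2·[a/2^k]⁺_f ∈ ℤ₂`
(`norm_ratPlusSymbol_div_two_pow_le_two_of_even`). [folklore] -/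
private theorem exists_padicInt_coe_eq_two_mul_ratPlusSymbol (hf0 : IsNewform0 f) (hQ : coeffField f = ⊥)
    (hN : ¬ 2 ∣ N) {ap : ℤ} (hap : cuspCoeff f 2 = ap) (hpa : (2 : ℤ) ∣ ap) (a k : ℕ) :
    ∃ z : ℤ_[2], (z : ℚ_[2]) = 2 * ((ratPlusSymbol f ((a : ℚ) / (2 : ℚ) ^ k) : ℚ) : ℚ_[2]) := by
  have h := norm_ratPlusSymbol_div_two_pow_le_two_of_even hf0 hQ hN hap hpa a k
  have h2 : ‖(2 : ℚ_[2])‖ = (2 : ℝ)⁻¹ := by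
    have h' := Padic.norm_p (p := 2)
    simpa using h'
  have hnorm : ‖2 * ((ratPlusSymbol f ((a : ℚ) / (2 : ℚ) ^ k) : ℚ) : ℚ_[2])‖ ≤ 1 := by
    rw [norm_mul, h2]
    calc (2 : ℝ)⁻¹ * _ ≤ (2 : ℝ)⁻¹ * 2 := by gcongr
      _ = 1 := by norm_num
  exact ⟨⟨_, hnorm⟩, rfl⟩

/-- **The finite-level functional equation of `θ_n` at `2`, doubled and integral.** Let `f` be the
rational newform of odd level `N` with `a₂(f)` even, `f|w_N = −σ f` (`σ = ±1`), and let
`N = η_N · 5^{c}` `2`-adically (`c ∈ ℤ₂`, `exists_teichmuller_exponent_natCast`), `c_n` the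
representative of `c mod 2ⁿ` in `[0, 2ⁿ)`. Then in `ℚ₂⟦T⟧`:
`2·(θ_n(T^ι) − σ·(1+T)^{c_n}·θ_n(T)) ∈ ω_n · Λ`.
Proof: the involution `u ↦ −1/(Nu)` of `(ℤ/2^{n+2})^×` (`finsum_sum_classes_eq_mul_of_symmetry`)
with the Fricke symmetry of the doubled integral symbols `2[u/2^{n+2}]⁺ = σ·2[u'/2^{n+2}]⁺`, then
term by term `(1+T)^{(−s_N−s) mod 2ⁿ + c_n} − (1+T)^{−s} = (1+T)^{−s}((1+T)^{2ⁿk} − 1) ∈ ω_n Λ`.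
[cite: MazurTateTeitelbaum1986Invent, §I.17] -/
theorem exists_two_mul_mazurTateElement_fe (hf0 : IsNewform0 f) (hQ : coeffField f = ⊥)
    (hN : ¬ 2 ∣ N) {ap : ℤ} (hap : cuspCoeff f 2 = ap) (hpa : (2 : ℤ) ∣ ap) {σ : ℤ}
    (hσ : σ ^ 2 = 1) (hW : IsFrickeEigen N f (-(σ : ℂ)))
    {ηN : rootsOfUnity (torsionOrder 2) ℤ_[2]} {c : ℤ_[2]}
    (hc : ∀ n : ℕ, PadicInt.toZModPow (n + cyclotomicExponent 2) ((ηN : ℤ_[2]ˣ) : ℤ_[2]) *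
      (cyclotomicGenerator 2 : ZMod (2 ^ (n + cyclotomicExponent 2))) ^
        (PadicInt.toZModPow n c).val = (N : ZMod (2 ^ (n + cyclotomicExponent 2))))
    (n : ℕ) :
    ∃ r : IwasawaAlgebra 2,
      PowerSeries.C (2 : ℚ_[2]) *
          ((((mazurTateElement f 2 n).map (algebraMap ℚ ℚ_[2]) : Polynomial ℚ_[2]) :
              ℚ_[2]⟦X⟧).subst (invOnePlusSubOne : ℚ_[2]⟦X⟧) -
            PowerSeries.C ((σ : ℤ) : ℚ_[2]) * (1 + X : ℚ_[2]⟦X⟧) ^ (PadicInt.toZModPow n c).val *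
              (((mazurTateElement f 2 n).map (algebraMap ℚ ℚ_[2]) : Polynomial ℚ_[2]) :
                ℚ_[2]⟦X⟧)) =
        iwasawaToPowerSeries 2 (((cyclotomicOmega 2 n).map (Int.castRingHom ℤ_[2]) :
          PowerSeries ℤ_[2])) * iwasawaToPowerSeries 2 r := by
  classical
  haveI := neZero_torsionOrder 2
  haveI : Fintype (rootsOfUnity (torsionOrder 2) ℤ_[2]) := Fintype.ofFinite _
  haveI : NeZero (2 ^ n) := ⟨pow_ne_zero _ two_ne_zero⟩
  haveI : NeZero (2 ^ (n + cyclotomicExponent 2)) := ⟨pow_ne_zero _ two_ne_zero⟩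
  have hιΛ := hasSubst_invOnePlusSubOne (R := ℤ_[2])
  have hιK := hasSubst_invOnePlusSubOne (R := ℚ_[2])
  -- notation (all classes at level `2^{n+e₀}`)
  set sN : ZMod (2 ^ n) := PadicInt.toZModPow n c with hsN
  set P : IwasawaAlgebra 2 := (1 + X : ℤ_[2]⟦X⟧) with hP
  set E : IwasawaAlgebra 2 := (invOnePlusSubOne : ℤ_[2]⟦X⟧) + 1 with hE
  have hPE : P * E = 1 := one_add_X_mul_E
  -- the doubled integral weights
  have hz : ∀ u : ZMod (2 ^ (n + cyclotomicExponent 2)), ∃ z : ℤ_[2], (z : ℚ_[2]) =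
      2 * ((ratPlusSymbol f ((u.val : ℚ) / (2 : ℚ) ^ (n + cyclotomicExponent 2)) : ℚ) : ℚ_[2]) :=
    fun u ↦ exists_padicInt_coe_eq_two_mul_ratPlusSymbol hf0 hQ hN hap hpa u.val _
  choose z hz using hz
  -- their Fricke symmetry
  have hzsym : ∀ u u' : ZMod (2 ^ (n + cyclotomicExponent 2)),
      (N : ZMod (2 ^ (n + cyclotomicExponent 2))) * u * u' = -1 → z u = (σ : ℤ_[2]) * z u' := by
    intro u u' h
    have hdvd : ((2 ^ (n + cyclotomicExponent 2) : ℕ) : ℤ) ∣ (N : ℤ) * u.val * u'.val + 1 := by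
      rw [← ZMod.intCast_zmod_eq_zero_iff_dvd]
      push_cast
      rw [ZMod.natCast_zmod_val, ZMod.natCast_zmod_val, h, neg_add_cancel]
    obtain ⟨A, hA⟩ := hdvd
    have h1 : A * ((2 ^ (n + cyclotomicExponent 2) : ℕ) : ℤ) - (u.val : ℤ) * (N * (u'.val : ℤ)) =
        1 := by
      linear_combination -hA
    have k1 := ratPlusSymbol_eq_mul_of_normalizedPlusSymbol_eq f hσ
      (hW.normalizedPlusSymbol_div_eq_mul hσ (pow_pos two_pos _) h1)
    push_cast at k1
    apply PadicInt.ext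
    rw [PadicInt.coe_mul, hz u, hz u', k1]
    push_cast
    ring
  -- the weights in `Λ` and their symmetry
  have hw : ∀ u u' : ZMod (2 ^ (n + cyclotomicExponent 2)),
      (N : ZMod (2 ^ (n + cyclotomicExponent 2))) * u * u' = -1 →
        PowerSeries.C (z u) = (σ : IwasawaAlgebra 2) * PowerSeries.C (z u') := by
    intro u u' h
    rw [hzsym u u' h, map_mul, map_intCast]
  -- the integral doubled class sum and its image `2 θ_n`
  set Θ2 : IwasawaAlgebra 2 := ∑ᶠ ξ : rootsOfUnity (torsionOrder 2) ℤ_[2], ∑ s : ZMod (2 ^ n),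
    PowerSeries.C (z (PadicInt.toZModPow (n + cyclotomicExponent 2) ((ξ : ℤ_[2]ˣ) : ℤ_[2]) *
      (cyclotomicGenerator 2 : ZMod (2 ^ (n + cyclotomicExponent 2))) ^ s.val)) * P ^ s.val
    with hΘ2
  have hΘ2K : iwasawaToPowerSeries 2 Θ2 = PowerSeries.C (2 : ℚ_[2]) *
      ((((mazurTateElement f 2 n).map (algebraMap ℚ ℚ_[2])) : Polynomial ℚ_[2]) : ℚ_[2]⟦X⟧) := by
    rw [coe_map_mazurTateElement_two, hΘ2, finsum_eq_sum_of_fintype, finsum_eq_sum_of_fintype,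
      map_sum, Finset.mul_sum]
    refine Finset.sum_congr rfl fun ξ _ ↦ ?_
    rw [map_sum, Finset.mul_sum]
    refine Finset.sum_congr rfl fun s _ ↦ ?_
    rw [map_mul, map_pow, hP, map_add, map_one, PowerSeries.map_X, PowerSeries.map_C,
      PadicInt.algebraMap_apply, hz, map_mul, mul_assoc]
  -- `σ² = 1` in `Λ`
  have hσΛ : (σ : IwasawaAlgebra 2) * (σ : IwasawaAlgebra 2) = 1 := by
    have h := congrArg (Int.cast : ℤ → IwasawaAlgebra 2) hσ
    push_cast at h
    rw [← sq]; exact h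
  -- reindexing along `u ↦ -1/(Nu)`
  have hre : Θ2 = (σ : IwasawaAlgebra 2) *
      ∑ᶠ ξ : rootsOfUnity (torsionOrder 2) ℤ_[2], ∑ s : ZMod (2 ^ n),
        PowerSeries.C (z (PadicInt.toZModPow (n + cyclotomicExponent 2) ((ξ : ℤ_[2]ˣ) : ℤ_[2]) *
          (cyclotomicGenerator 2 : ZMod (2 ^ (n + cyclotomicExponent 2))) ^ s.val)) *
            P ^ (-sN - s).val :=
    finsum_sum_classes_eq_mul_of_symmetry 2 n hw (hc n) (fun s ↦ P ^ s.val)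
  -- `Θ2(T^ι)`
  have hSΘ : Θ2.subst (invOnePlusSubOne : ℤ_[2]⟦X⟧) =
      ∑ ξ : rootsOfUnity (torsionOrder 2) ℤ_[2], ∑ s : ZMod (2 ^ n),
        PowerSeries.C (z (PadicInt.toZModPow (n + cyclotomicExponent 2) ((ξ : ℤ_[2]ˣ) : ℤ_[2]) *
          (cyclotomicGenerator 2 : ZMod (2 ^ (n + cyclotomicExponent 2))) ^ s.val)) *
            E ^ s.val := by
    rw [hΘ2, finsum_eq_sum_of_fintype, ← coe_substAlgHom hιΛ, map_sum]
    refine Finset.sum_congr rfl fun ξ _ ↦ ?_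
    rw [map_sum]
    refine Finset.sum_congr rfl fun s _ ↦ ?_
    rw [map_mul, map_pow, C_eq_algebraMap, AlgHom.commutes, coe_substAlgHom hιΛ, hP,
      subst_invOnePlusSubOne_one_add_X, ← hE]
  -- the exponents `(-sN - s).val + sN.val + s.val` are multiples of `2ⁿ`
  have hdiv : ∀ s : ZMod (2 ^ n), 2 ^ n ∣ (-sN - s).val + sN.val + s.val := by
    intro s
    rw [← ZMod.natCast_eq_zero_iff]
    push_cast
    rw [ZMod.natCast_zmod_val, ZMod.natCast_zmod_val, ZMod.natCast_zmod_val]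
    ring
  choose k hk using hdiv
  -- termwise identity
  have hterm : ∀ (zz : ℤ_[2]) (s : ZMod (2 ^ n)),
      PowerSeries.C zz * E ^ s.val - P ^ sN.val * (PowerSeries.C zz * P ^ (-sN - s).val) =
        (P ^ 2 ^ n - 1) * -(PowerSeries.C zz * E ^ s.val *
          ∑ i ∈ Finset.range (k s), (P ^ 2 ^ n) ^ i) := by
    intro zz s
    have e1 := geom_sum_mul (P ^ 2 ^ n) (k s)
    have e2 : P ^ (-sN - s).val * P ^ sN.val * P ^ s.val = (P ^ 2 ^ n) ^ (k s) := by
      rw [← pow_add, ← pow_add, hk s, pow_mul]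
    have e3 : P ^ s.val * E ^ s.val = 1 := one_add_X_pow_mul_E_pow s.val
    linear_combination (PowerSeries.C zz * E ^ s.val) * e1 -
      (PowerSeries.C zz * E ^ s.val) * e2 + (PowerSeries.C zz * P ^ (-sN - s).val * P ^ sN.val) * e3
  -- the identity in `Λ`
  set r : IwasawaAlgebra 2 := ∑ ξ : rootsOfUnity (torsionOrder 2) ℤ_[2], ∑ s : ZMod (2 ^ n),
    -(PowerSeries.C (z (PadicInt.toZModPow (n + cyclotomicExponent 2) ((ξ : ℤ_[2]ˣ) : ℤ_[2]) *
        (cyclotomicGenerator 2 : ZMod (2 ^ (n + cyclotomicExponent 2))) ^ s.val)) * E ^ s.val *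
      ∑ i ∈ Finset.range (k s), (P ^ 2 ^ n) ^ i) with hr
  have hΛ : Θ2.subst (invOnePlusSubOne : ℤ_[2]⟦X⟧) - (σ : IwasawaAlgebra 2) * P ^ sN.val * Θ2 =
      (((cyclotomicOmega 2 n).map (Int.castRingHom ℤ_[2]) : Polynomial ℤ_[2]) : ℤ_[2]⟦X⟧) * r := by
    rw [hSΘ, coe_map_cyclotomicOmega, ← hP]
    conv_lhs => rw [hre]
    rw [finsum_eq_sum_of_fintype]
    set S2 := ∑ ξ : rootsOfUnity (torsionOrder 2) ℤ_[2], ∑ s : ZMod (2 ^ n),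
      PowerSeries.C (z (PadicInt.toZModPow (n + cyclotomicExponent 2) ((ξ : ℤ_[2]ˣ) : ℤ_[2]) *
        (cyclotomicGenerator 2 : ZMod (2 ^ (n + cyclotomicExponent 2))) ^ s.val)) *
          P ^ (-sN - s).val with hS2
    have hσσ : (σ : IwasawaAlgebra 2) * P ^ sN.val * ((σ : IwasawaAlgebra 2) * S2) =
        P ^ sN.val * S2 := by
      linear_combination (P ^ sN.val * S2) * hσΛ
    rw [hσσ, hS2, hr, Finset.mul_sum, Finset.mul_sum, ← Finset.sum_sub_distrib]
    refine Finset.sum_congr rfl fun ξ _ ↦ ?_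
    rw [Finset.mul_sum, Finset.mul_sum, ← Finset.sum_sub_distrib]
    refine Finset.sum_congr rfl fun s _ ↦ ?_
    exact hterm _ s
  -- map to `ℚ₂⟦T⟧`
  refine ⟨r, ?_⟩
  have hK := congrArg (iwasawaToPowerSeries 2) hΛ
  rw [map_sub, map_mul, map_mul, map_mul, map_pow, map_intCast,
    iwasawaToPowerSeries_subst_invOnePlusSubOne, hΘ2K, hP, map_add, map_one, PowerSeries.map_X,
    subst_mul hιK, ← coe_substAlgHom hιK, C_eq_algebraMap, AlgHom.commutes, coe_substAlgHom hιK]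
    at hK
  rw [C_eq_algebraMap, map_intCast]
  linear_combination hK

end FiniteLevel

/-! ## §5. The `2`-adic exponents `a = −2/3`, `b = −1/3` of the chromatic weights -/

section Exponents

/-- `3` is a unit of `ℤ₂`, so `3x = t` is solvable. [folklore] -/
private theorem exists_three_mul_eq (t : ℤ_[2]) : ∃ x : ℤ_[2], 3 * x = t := by
  have h3 : IsUnit (3 : ℤ_[2]) := by
    rw [PadicInt.isUnit_iff]
    have h : ‖((3 : ℤ) : ℤ_[2])‖ = 1 := by
      rw [PadicInt.norm_intCast_eq_one_iff]
      decide
    exact_mod_cast h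
  obtain ⟨u, hu⟩ := h3
  exact ⟨(↑u⁻¹ : ℤ_[2]) * t, by rw [← mul_assoc, ← hu, Units.mul_inv, one_mul]⟩

/-- `2ⁿ mod 3`: `2` for odd `n`, `1` for even `n`; hence `3·⌊2ⁿ/3⌋ = 2ⁿ − 2` resp. `2ⁿ − 1`.
[folklore] -/
private theorem three_mul_two_pow_div_three_odd (k : ℕ) : 3 * (2 ^ (2 * k + 1) / 3) + 2 = 2 ^ (2 * k + 1) := by
  have h : 2 ^ (2 * k + 1) % 3 = 2 := by
    rw [pow_succ, pow_mul, Nat.mul_mod, Nat.pow_mod]; norm_num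
  have := Nat.div_add_mod (2 ^ (2 * k + 1)) 3
  omega

/-- Even case of the previous lemma. [folklore] -/
private theorem three_mul_two_pow_div_three_even (k : ℕ) : 3 * (2 ^ (2 * k) / 3) + 1 = 2 ^ (2 * k) := by
  have h : 2 ^ (2 * k) % 3 = 1 := by
    rw [pow_mul, Nat.pow_mod]; norm_num
  have := Nat.div_add_mod (2 ^ (2 * k)) 3
  omega

/-- **`a = −2/3 ∈ ℤ₂` interpolates the odd-level weights**: if `3a = −2` then
`a ≡ ⌊2ⁿ/3⌋ (mod 2ⁿ)` for every ODD `n` (`3(a − ⌊2ⁿ/3⌋) = −2ⁿ`). [folklore] -/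
private theorem toZModPow_eq_two_pow_div_three_of_odd {a : ℤ_[2]} (ha : 3 * a = -2) (k : ℕ) :
    PadicInt.toZModPow (2 * k + 1) a = ((2 ^ (2 * k + 1) / 3 : ℕ) : ZMod (2 ^ (2 * k + 1))) := by
  set n := 2 * k + 1 with hn
  obtain ⟨u, hu⟩ := exists_three_mul_eq (1 : ℤ_[2])
  have hdiff : a - ((2 ^ n / 3 : ℕ) : ℤ_[2]) = (2 : ℤ_[2]) ^ n * (-u) := by
    have h3 : (3 : ℤ_[2]) * ((2 ^ n / 3 : ℕ) : ℤ_[2]) + 2 = (2 : ℤ_[2]) ^ n := by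
      exact_mod_cast three_mul_two_pow_div_three_odd k
    linear_combination u * ha - u * h3 - (a - ((2 ^ n / 3 : ℕ) : ℤ_[2])) * hu
  have hker : a - ((2 ^ n / 3 : ℕ) : ℤ_[2]) ∈ RingHom.ker (PadicInt.toZModPow (p := 2) n) := by
    rw [PadicInt.ker_toZModPow, Ideal.mem_span_singleton]
    exact ⟨-u, by rw [hdiff]; push_cast; ring⟩
  rw [RingHom.mem_ker, map_sub, map_natCast, sub_eq_zero] at hker
  exact hker

/-- **`b = −1/3 ∈ ℤ₂` interpolates the even-level weights**: if `3b = −1` then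
`b ≡ ⌊2ⁿ/3⌋ (mod 2ⁿ)` for every EVEN `n`. [folklore] -/
private theorem toZModPow_eq_two_pow_div_three_of_even {b : ℤ_[2]} (hb : 3 * b = -1) (k : ℕ) :
    PadicInt.toZModPow (2 * k) b = ((2 ^ (2 * k) / 3 : ℕ) : ZMod (2 ^ (2 * k))) := by
  set n := 2 * k with hn
  obtain ⟨u, hu⟩ := exists_three_mul_eq (1 : ℤ_[2])
  have hdiff : b - ((2 ^ n / 3 : ℕ) : ℤ_[2]) = (2 : ℤ_[2]) ^ n * (-u) := by
    have h3 : (3 : ℤ_[2]) * ((2 ^ n / 3 : ℕ) : ℤ_[2]) + 1 = (2 : ℤ_[2]) ^ n := by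
      exact_mod_cast three_mul_two_pow_div_three_even k
    linear_combination u * hb - u * h3 - (b - ((2 ^ n / 3 : ℕ) : ℤ_[2])) * hu
  have hker : b - ((2 ^ n / 3 : ℕ) : ℤ_[2]) ∈ RingHom.ker (PadicInt.toZModPow (p := 2) n) := by
    rw [PadicInt.ker_toZModPow, Ideal.mem_span_singleton]
    exact ⟨-u, by rw [hdiff]; push_cast; ring⟩
  rw [RingHom.mem_ker, map_sub, map_natCast, sub_eq_zero] at hker
  exact hker

end Exponents

/-! ## §6. Transport of the Mazur–Tate congruences under `ι` and the functional equation -/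

section Transport

/-- `ι_Λ(ι) = ι`. [folklore] -/
private theorem iwasawaToPowerSeries_invOnePlusSubOne {p : ℕ} [Fact p.Prime] :
    iwasawaToPowerSeries p (invOnePlusSubOne : ℤ_[p]⟦X⟧) = invOnePlusSubOne :=
  map_invOnePlusSubOne _

/-- `ι_Λ(u) = u` for the image `u` of an integer polynomial. [folklore] -/
private theorem iwasawaToPowerSeries_toIwasawa {p : ℕ} [Fact p.Prime] (q : Polynomial ℤ) :
    iwasawaToPowerSeries p (toIwasawa p q) =
      ((q.map (Int.castRingHom ℚ_[p]) : Polynomial ℚ_[p]) : ℚ_[p]⟦X⟧) := by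
  change PowerSeries.map (algebraMap ℤ_[p] ℚ_[p])
    (((q.map (Int.castRingHom ℤ_[p])) : Polynomial ℤ_[p]) : ℤ_[p]⟦X⟧) = _
  rw [← Polynomial.polynomial_map_coe, Polynomial.map_map,
    RingHom.ext_int ((algebraMap ℤ_[p] ℚ_[p]).comp (Int.castRingHom ℤ_[p])) (Int.castRingHom ℚ_[p])]

/-- **Chromatic weights versus binomial series, odd/even levels.** If `toZModPow m x = j` then
`E^j − (1+T)^{−x}·… `: precisely, with `B(y) = (1+T)^y` the binomial series in `Λ = ℤ₂⟦T⟧`,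
`E^j − B(−x) ∈ ω_m Λ` where `E = (1+T)⁻¹`, `ω_m = (1+T)^{2^m} − 1`. [folklore] -/
private theorem exists_E_pow_sub_binomialSeries_neg_eq {m : ℕ} {x : ℤ_[2]} {j : ℕ}
    (hx : PadicInt.toZModPow m x = (j : ZMod (2 ^ m))) :
    ∃ q : ℤ_[2]⟦X⟧, ((invOnePlusSubOne : ℤ_[2]⟦X⟧) + 1) ^ j -
        PowerSeries.binomialSeries ℤ_[2] (-x) = ((1 + X : ℤ_[2]⟦X⟧) ^ (2 ^ m) - 1) * q := by
  obtain ⟨q₁, hq₁⟩ := exists_binomialSeries_sub_pow_eq hx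
  have hBB : PowerSeries.binomialSeries ℤ_[2] (-x) * PowerSeries.binomialSeries ℤ_[2] x = 1 := by
    rw [← PowerSeries.binomialSeries_add, neg_add_cancel, PowerSeries.binomialSeries_zero]
  have hPE := one_add_X_pow_mul_E_pow (R := ℤ_[2]) j
  refine ⟨((invOnePlusSubOne : ℤ_[2]⟦X⟧) + 1) ^ j * PowerSeries.binomialSeries ℤ_[2] (-x) * q₁, ?_⟩
  linear_combination (((invOnePlusSubOne : ℤ_[2]⟦X⟧) + 1) ^ j *
      PowerSeries.binomialSeries ℤ_[2] (-x)) * hq₁ -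
    ((invOnePlusSubOne : ℤ_[2]⟦X⟧) + 1) ^ j * hBB + PowerSeries.binomialSeries ℤ_[2] (-x) * hPE

variable {N : ℕ} [NeZero N] {f : CuspForm (Gamma0 N) 2}

/-- The `U`-term of the transported congruence (odd/even levels): with `A' = σ·(1+T)^{−(c+a)}·L(T^ι)`,
`u·(σ E^{c_m} E^{⌊2^m/3⌋} L(T^ι)) − u·A' ∈ ω_m Λ` (at even `m`, `u_m = 0`; at odd `m`,
`a ≡ ⌊2^m/3⌋ (mod 2^m)`). [folklore] -/
private theorem exists_sharp_term_transport {m : ℕ} {c a : ℤ_[2]} (ha : 3 * a = -2) (σ : ℤ)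
    (L : IwasawaAlgebra 2) :
    ∃ δ : IwasawaAlgebra 2,
      iwasawaToPowerSeries 2 (toIwasawa 2 (sharpPoly 0 2 m)) *
          (((σ : ℤ) : ℚ_[2]⟦X⟧) * ((invOnePlusSubOne : ℚ_[2]⟦X⟧) + 1) ^ (PadicInt.toZModPow m c).val *
            ((invOnePlusSubOne : ℚ_[2]⟦X⟧) + 1) ^ (2 ^ m / 3) *
            iwasawaToPowerSeries 2 (L.subst (invOnePlusSubOne : ℤ_[2]⟦X⟧))) -
        iwasawaToPowerSeries 2 (toIwasawa 2 (sharpPoly 0 2 m)) *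
          (((σ : ℤ) : ℚ_[2]⟦X⟧) *
            iwasawaToPowerSeries 2 (PowerSeries.binomialSeries ℤ_[2] (-(c + a))) *
            iwasawaToPowerSeries 2 (L.subst (invOnePlusSubOne : ℤ_[2]⟦X⟧))) =
      iwasawaToPowerSeries 2 (((cyclotomicOmega 2 m).map (Int.castRingHom ℤ_[2]) :
        Polynomial ℤ_[2]) : ℤ_[2]⟦X⟧) * iwasawaToPowerSeries 2 δ := by
  haveI : NeZero (2 ^ m) := ⟨pow_ne_zero _ two_ne_zero⟩
  rcases Nat.even_or_odd m with ⟨k, hk⟩ | ⟨k, hk⟩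
  · have hu : sharpPoly 0 2 m = 0 := by rw [hk, ← two_mul]; exact sharpPoly_zero_two_mul 2 k
    refine ⟨0, ?_⟩
    rw [hu, map_zero, map_zero]; ring
  · subst hk
    have hx : PadicInt.toZModPow (2 * k + 1) (c + a) =
        (((PadicInt.toZModPow (2 * k + 1) c).val + 2 ^ (2 * k + 1) / 3 : ℕ) :
          ZMod (2 ^ (2 * k + 1))) := by
      rw [map_add, toZModPow_eq_two_pow_div_three_of_odd ha k, Nat.cast_add, ZMod.natCast_zmod_val]
    obtain ⟨q₁, hq₁⟩ := exists_E_pow_sub_binomialSeries_neg_eq hx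
    refine ⟨(σ : IwasawaAlgebra 2) * toIwasawa 2 (sharpPoly 0 2 (2 * k + 1)) *
      L.subst (invOnePlusSubOne : ℤ_[2]⟦X⟧) * q₁, ?_⟩
    have hK := congrArg (iwasawaToPowerSeries 2) hq₁
    simp only [map_sub, map_mul, map_pow, map_add, map_one, PowerSeries.map_X,
      iwasawaToPowerSeries_invOnePlusSubOne] at hK
    rw [coe_map_cyclotomicOmega]
    simp only [map_sub, map_mul, map_pow, map_add, map_one, PowerSeries.map_X, map_intCast]
    linear_combination (iwasawaToPowerSeries 2 (toIwasawa 2 (sharpPoly 0 2 (2 * k + 1))) *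
      ((σ : ℤ) : ℚ_[2]⟦X⟧) * iwasawaToPowerSeries 2 (L.subst (invOnePlusSubOne : ℤ_[2]⟦X⟧))) * hK

/-- The `V`-term of the transported congruence (odd/even levels), with `b`, `3b = −1`. [folklore] -/
private theorem exists_flat_term_transport {m : ℕ} {c b : ℤ_[2]} (hb : 3 * b = -1) (σ : ℤ)
    (L : IwasawaAlgebra 2) :
    ∃ δ : IwasawaAlgebra 2,
      iwasawaToPowerSeries 2 (toIwasawa 2 (flatPoly 0 2 m)) *
          (((σ : ℤ) : ℚ_[2]⟦X⟧) * ((invOnePlusSubOne : ℚ_[2]⟦X⟧) + 1) ^ (PadicInt.toZModPow m c).val *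
            ((invOnePlusSubOne : ℚ_[2]⟦X⟧) + 1) ^ (2 ^ m / 3) *
            iwasawaToPowerSeries 2 (L.subst (invOnePlusSubOne : ℤ_[2]⟦X⟧))) -
        iwasawaToPowerSeries 2 (toIwasawa 2 (flatPoly 0 2 m)) *
          (((σ : ℤ) : ℚ_[2]⟦X⟧) *
            iwasawaToPowerSeries 2 (PowerSeries.binomialSeries ℤ_[2] (-(c + b))) *
            iwasawaToPowerSeries 2 (L.subst (invOnePlusSubOne : ℤ_[2]⟦X⟧))) =
      iwasawaToPowerSeries 2 (((cyclotomicOmega 2 m).map (Int.castRingHom ℤ_[2]) :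
        Polynomial ℤ_[2]) : ℤ_[2]⟦X⟧) * iwasawaToPowerSeries 2 δ := by
  haveI : NeZero (2 ^ m) := ⟨pow_ne_zero _ two_ne_zero⟩
  rcases Nat.even_or_odd m with ⟨k, hk⟩ | ⟨k, hk⟩
  · rw [← two_mul] at hk
    subst hk
    have hx : PadicInt.toZModPow (2 * k) (c + b) =
        (((PadicInt.toZModPow (2 * k) c).val + 2 ^ (2 * k) / 3 : ℕ) : ZMod (2 ^ (2 * k))) := by
      rw [map_add, toZModPow_eq_two_pow_div_three_of_even hb k, Nat.cast_add,
        ZMod.natCast_zmod_val]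
    obtain ⟨q₁, hq₁⟩ := exists_E_pow_sub_binomialSeries_neg_eq hx
    refine ⟨(σ : IwasawaAlgebra 2) * toIwasawa 2 (flatPoly 0 2 (2 * k)) *
      L.subst (invOnePlusSubOne : ℤ_[2]⟦X⟧) * q₁, ?_⟩
    have hK := congrArg (iwasawaToPowerSeries 2) hq₁
    simp only [map_sub, map_mul, map_pow, map_add, map_one, PowerSeries.map_X,
      iwasawaToPowerSeries_invOnePlusSubOne] at hK
    rw [coe_map_cyclotomicOmega]
    simp only [map_sub, map_mul, map_pow, map_add, map_one, PowerSeries.map_X, map_intCast]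
    linear_combination (iwasawaToPowerSeries 2 (toIwasawa 2 (flatPoly 0 2 (2 * k))) *
      ((σ : ℤ) : ℚ_[2]⟦X⟧) * iwasawaToPowerSeries 2 (L.subst (invOnePlusSubOne : ℤ_[2]⟦X⟧))) * hK
  · have hv : flatPoly 0 2 m = 0 := by rw [hk]; exact flatPoly_zero_two_mul_add_one 2 k
    refine ⟨0, ?_⟩
    rw [hv, map_zero, map_zero]; ring

/-- **Transport of Sprung's congruences under `T ↦ T^ι` (`p = 2`, `a₂ = 0`).** Let `f` be the
rational newform of odd level `N` with `a₂(f) = 0`, Fricke sign `−σ`, `2`-adic exponent `c` of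
`⟨N⟩` (`N = η_N 5^c`), and let `a, b ∈ ℤ₂` with `3a = −2`, `3b = −1`. If `(L♯, L♭)` satisfies the
Mazur–Tate congruences `θ_n ≡ −(u_n L♯ + v_n L♭) (mod ω_n)` at every level, then so does the pair
`(σ·(1+T)^{−(c+a)}·L♯(T^ι), σ·(1+T)^{−(c+b)}·L♭(T^ι))`. Ingredients: the finite-level functional
equation of `θ_n` (`exists_two_mul_mazurTateElement_fe`), `ι(ω_n) = −E^{2ⁿ}ω_n`, the
`ι`-homogeneity `ι(u_n) = E^{⌊2ⁿ/3⌋}u_n`, `ι(v_n) = E^{⌊2ⁿ/3⌋}v_n`, the vanishing `u_{2k} = 0`,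
`v_{2k+1} = 0`, and `(1+T)^{−(c+a)} ≡ E^{c_n + ⌊2ⁿ/3⌋} (mod ω_n)` at odd `n` (resp. `b`, even `n`).
[cite: Sprung2017, Thm. 1.12 and Cor. 4.4 (shape of the congruences)] -/
theorem isSprungPair_two_zero_transport (hf0 : IsNewform0 f) (hQ : coeffField f = ⊥)
    (hN : ¬ 2 ∣ N) (hap : cuspCoeff f 2 = ((0 : ℤ) : ℂ)) {σ : ℤ} (hσ : σ ^ 2 = 1)
    (hW : IsFrickeEigen N f (-(σ : ℂ))) {ηN : rootsOfUnity (torsionOrder 2) ℤ_[2]} {c : ℤ_[2]}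
    (hc : ∀ n : ℕ, PadicInt.toZModPow (n + cyclotomicExponent 2) ((ηN : ℤ_[2]ˣ) : ℤ_[2]) *
      (cyclotomicGenerator 2 : ZMod (2 ^ (n + cyclotomicExponent 2))) ^
        (PadicInt.toZModPow n c).val = (N : ZMod (2 ^ (n + cyclotomicExponent 2))))
    {a b : ℤ_[2]} (ha : 3 * a = -2) (hb : 3 * b = -1) {Ls Lf : IwasawaAlgebra 2}
    (h : IsSprungPair f 2 0 Ls Lf) :
    IsSprungPair f 2 0
      ((σ : IwasawaAlgebra 2) * PowerSeries.binomialSeries ℤ_[2] (-(c + a)) *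
        Ls.subst (invOnePlusSubOne : ℤ_[2]⟦X⟧))
      ((σ : IwasawaAlgebra 2) * PowerSeries.binomialSeries ℤ_[2] (-(c + b)) *
        Lf.subst (invOnePlusSubOne : ℤ_[2]⟦X⟧)) := by
  classical
  have hιK := hasSubst_invOnePlusSubOne (R := ℚ_[2])
  intro m
  obtain ⟨e, q, hq⟩ := h m
  obtain ⟨r, hr⟩ := exists_two_mul_mazurTateElement_fe hf0 hQ hN hap (dvd_zero 2) hσ hW hc m
  obtain ⟨δU, hδU⟩ := exists_sharp_term_transport (m := m) (c := c) ha σ Ls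
  obtain ⟨δV, hδV⟩ := exists_flat_term_transport (m := m) (c := c) hb σ Lf
  refine ⟨e + 1, -2 * (σ : IwasawaAlgebra 2) *
    ((invOnePlusSubOne : ℤ_[2]⟦X⟧) + 1) ^ (PadicInt.toZModPow m c).val *
    ((invOnePlusSubOne : ℤ_[2]⟦X⟧) + 1) ^ (2 ^ m) * q.subst (invOnePlusSubOne : ℤ_[2]⟦X⟧) -
    2 ^ e * (σ : IwasawaAlgebra 2) * ((invOnePlusSubOne : ℤ_[2]⟦X⟧) + 1) ^
      (PadicInt.toZModPow m c).val * r - 2 ^ (e + 1) * (δU + δV), ?_⟩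
  simp only [Polynomial.map_neg, Polynomial.map_one, Polynomial.coe_neg, Polynomial.coe_one,
    neg_one_mul, map_neg, sub_neg_eq_add, map_add, map_sub, map_mul, map_pow, Nat.cast_ofNat,
    map_ofNat, map_intCast, map_one, iwasawaToPowerSeries_invOnePlusSubOne] at hq ⊢
  rw [map_ofNat, map_intCast] at hr
  -- `ι(ω) = −E^{2^m} ω`
  have hSω : (iwasawaToPowerSeries 2 (((cyclotomicOmega 2 m).map (Int.castRingHom ℤ_[2]) :
      Polynomial ℤ_[2]) : ℤ_[2]⟦X⟧)).subst (invOnePlusSubOne : ℚ_[2]⟦X⟧) =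
        -((invOnePlusSubOne : ℚ_[2]⟦X⟧) + 1) ^ (2 ^ m) *
          iwasawaToPowerSeries 2 (((cyclotomicOmega 2 m).map (Int.castRingHom ℤ_[2]) :
            Polynomial ℤ_[2]) : ℤ_[2]⟦X⟧) := by
    have hωP : iwasawaToPowerSeries 2 (((cyclotomicOmega 2 m).map (Int.castRingHom ℤ_[2]) :
        Polynomial ℤ_[2]) : ℤ_[2]⟦X⟧) = (1 + X : ℚ_[2]⟦X⟧) ^ (2 ^ m) - 1 := by
      rw [coe_map_cyclotomicOmega, map_sub, map_pow, map_add, map_one, PowerSeries.map_X]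
    rw [hωP, subst_invOnePlusSubOne_omega]
  -- homogeneity of `u_m`, `v_m`
  have hSU : (iwasawaToPowerSeries 2 (toIwasawa 2 (sharpPoly 0 2 m))).subst
      (invOnePlusSubOne : ℚ_[2]⟦X⟧) = ((invOnePlusSubOne : ℚ_[2]⟦X⟧) + 1) ^ (2 ^ m / 3) *
        iwasawaToPowerSeries 2 (toIwasawa 2 (sharpPoly 0 2 m)) := by
    rw [iwasawaToPowerSeries_toIwasawa, subst_invOnePlusSubOne_sharpPoly_zero_two]
  have hSV : (iwasawaToPowerSeries 2 (toIwasawa 2 (flatPoly 0 2 m))).subst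
      (invOnePlusSubOne : ℚ_[2]⟦X⟧) = ((invOnePlusSubOne : ℚ_[2]⟦X⟧) + 1) ^ (2 ^ m / 3) *
        iwasawaToPowerSeries 2 (toIwasawa 2 (flatPoly 0 2 m)) := by
    rw [iwasawaToPowerSeries_toIwasawa, subst_invOnePlusSubOne_flatPoly_zero_two]
  -- the congruence for `(L♯, L♭)` under `ι`
  have hS := congrArg (PowerSeries.subst (invOnePlusSubOne : ℚ_[2]⟦X⟧)) hq
  simp only [← coe_substAlgHom hιK, map_mul, map_add, map_pow, map_ofNat] at hS
  rw [coe_substAlgHom hιK] at hS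
  rw [hSU, hSV, hSω, ← iwasawaToPowerSeries_subst_invOnePlusSubOne,
    ← iwasawaToPowerSeries_subst_invOnePlusSubOne,
    ← iwasawaToPowerSeries_subst_invOnePlusSubOne] at hS
  -- units
  have hσ2 : ((σ : ℤ) : ℚ_[2]⟦X⟧) * ((σ : ℤ) : ℚ_[2]⟦X⟧) = 1 := by
    have h := congrArg (Int.cast : ℤ → ℚ_[2]⟦X⟧) hσ
    push_cast at h
    rw [← sq]; exact h
  have hPEc : (1 + X : ℚ_[2]⟦X⟧) ^ (PadicInt.toZModPow m c).val *
      ((invOnePlusSubOne : ℚ_[2]⟦X⟧) + 1) ^ (PadicInt.toZModPow m c).val = 1 :=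
    one_add_X_pow_mul_E_pow _
  linear_combination
    (2 * ((σ : ℤ) : ℚ_[2]⟦X⟧) * ((invOnePlusSubOne : ℚ_[2]⟦X⟧) + 1) ^
      (PadicInt.toZModPow m c).val) * hS
    - ((2 : ℚ_[2]⟦X⟧) ^ e * ((σ : ℤ) : ℚ_[2]⟦X⟧) * ((invOnePlusSubOne : ℚ_[2]⟦X⟧) + 1) ^
      (PadicInt.toZModPow m c).val) * hr
    - (2 * (2 : ℚ_[2]⟦X⟧) ^ e *
        (((mazurTateElement f 2 m).map (algebraMap ℚ ℚ_[2]) : Polynomial ℚ_[2]) : ℚ_[2]⟦X⟧)) *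
      hPEc
    - (2 * (2 : ℚ_[2]⟦X⟧) ^ e *
        (((mazurTateElement f 2 m).map (algebraMap ℚ ℚ_[2]) : Polynomial ℚ_[2]) : ℚ_[2]⟦X⟧) *
        ((invOnePlusSubOne : ℚ_[2]⟦X⟧) + 1) ^ (PadicInt.toZModPow m c).val *
        (1 + X : ℚ_[2]⟦X⟧) ^ (PadicInt.toZModPow m c).val) * hσ2
    - (2 * (2 : ℚ_[2]⟦X⟧) ^ e) * hδU - (2 * (2 : ℚ_[2]⟦X⟧) ^ e) * hδV

end Transport

/-! ### §7. The functional equations of `L♯₂` and `L♭₂` (`a₂ = 0`) -/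

section FunctionalEquation

/-- `ι_Λ((1+T)^x) = (1+T)^x`: the binomial series with `ℤ_p`-exponent, coefficients read in `ℚ_p`.
[folklore] -/
private theorem iwasawaToPowerSeries_binomialSeries {p : ℕ} [Fact p.Prime] (x : ℤ_[p]) :
    iwasawaToPowerSeries p (PowerSeries.binomialSeries ℤ_[p] x) =
      PowerSeries.binomialSeries ℚ_[p] x := by
  change PowerSeries.map (algebraMap ℤ_[p] ℚ_[p]) _ = _
  ext n
  rw [coeff_map, binomialSeries_coeff, binomialSeries_coeff, smul_eq_mul, mul_one, Algebra.smul_def,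
    mul_one]

/-- From `L = σ(1+T)^{−x}L(T^ι)` with `σ² = 1` to `L(T^ι) = σ(1+T)^{x}L`. [folklore] -/
private theorem subst_invOnePlusSubOne_eq_of_eq_mul_subst {p : ℕ} [Fact p.Prime] {σ : ℤ} (hσ : σ ^ 2 = 1)
    {x : ℤ_[p]} {L : IwasawaAlgebra p}
    (h : L = (σ : IwasawaAlgebra p) * PowerSeries.binomialSeries ℤ_[p] (-x) *
      L.subst (invOnePlusSubOne : ℤ_[p]⟦X⟧)) :
    L.subst (invOnePlusSubOne : ℤ_[p]⟦X⟧) =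
      (σ : IwasawaAlgebra p) * PowerSeries.binomialSeries ℤ_[p] x * L := by
  have hB : PowerSeries.binomialSeries ℤ_[p] x * PowerSeries.binomialSeries ℤ_[p] (-x) =
      (1 : ℤ_[p]⟦X⟧) := by
    rw [← binomialSeries_add, add_neg_cancel, binomialSeries_zero]
  have hσ2 : (σ : IwasawaAlgebra p) * (σ : IwasawaAlgebra p) = 1 := by
    have h := congrArg (Int.cast : ℤ → IwasawaAlgebra p) hσ
    push_cast at h
    rw [← sq]; exact h
  calc L.subst (invOnePlusSubOne : ℤ_[p]⟦X⟧)
      = ((σ : IwasawaAlgebra p) * (σ : IwasawaAlgebra p)) *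
          (PowerSeries.binomialSeries ℤ_[p] x * PowerSeries.binomialSeries ℤ_[p] (-x)) *
          L.subst (invOnePlusSubOne : ℤ_[p]⟦X⟧) := by rw [hσ2, hB, one_mul, one_mul]
    _ = (σ : IwasawaAlgebra p) * PowerSeries.binomialSeries ℤ_[p] x *
          ((σ : IwasawaAlgebra p) * PowerSeries.binomialSeries ℤ_[p] (-x) *
            L.subst (invOnePlusSubOne : ℤ_[p]⟦X⟧)) := by ring
    _ = (σ : IwasawaAlgebra p) * PowerSeries.binomialSeries ℤ_[p] x * L := by rw [← h]

/-- Reading `L(T^ι) = σ(1+T)^x L` (in `Λ`) in `ℚ_p⟦T⟧`: `(ι_Λ L)(T^ι) = C σ · (1+T)^x · ι_Λ L`.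
[folklore] -/
private theorem subst_iwasawaToPowerSeries_eq_of_subst_eq {p : ℕ} [Fact p.Prime] {σ : ℤ} {x : ℤ_[p]}
    {L : IwasawaAlgebra p} (h : L.subst (invOnePlusSubOne : ℤ_[p]⟦X⟧) =
      (σ : IwasawaAlgebra p) * PowerSeries.binomialSeries ℤ_[p] x * L) :
    (iwasawaToPowerSeries p L).subst (invOnePlusSubOne : ℚ_[p]⟦X⟧) =
      C ((σ : ℤ) : ℚ_[p]) * PowerSeries.binomialSeries ℚ_[p] x * iwasawaToPowerSeries p L := by
  rw [← iwasawaToPowerSeries_subst_invOnePlusSubOne, h, map_mul, map_mul, map_intCast,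
    iwasawaToPowerSeries_binomialSeries, ← map_intCast (C : ℚ_[p] →+* ℚ_[p]⟦X⟧) σ]

variable {W : WeierstrassCurve ℚ} [W.IsElliptic] [W.IsGloballyMinimal] {N : ℕ} [NeZero N]
  {f : CuspForm (Gamma0 N) 2}

/-- **The functional equations of Sprung's `L♯₂(E,T)` and `L♭₂(E,T)` at a good supersingular
prime `2` with `a₂(E) = 0`, in `Λ = ℤ₂⟦T⟧, any level.** Let `f ∈ S₂(Γ₀(N))` be the newform of
the globally minimal elliptic `W`, `W` with good reduction at `2` and `a₂ = 0` (so `2 ∤ N`), let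
`w_N f = −σ f` (`σ = ±1`), write `N = η_N · 5^c` in `ℤ₂^× = μ₄ × (1 + 4ℤ₂)` (`c ∈ ℤ₂`,
`γ = cyclotomicGenerator 2 = 5`), and let `a = −2/3`, `b = −1/3 ∈ ℤ₂`. If `(L♯, L♭)` is a
Sprung pair of `f` at `2` (`IsSprungPair f 2 0 L♯ L♭`; it exists, `exists_isSprungPair_two`, and
is unique, `IsSprungPair.unique`), then
`L♯(T^ι) = σ (1+T)^{c+a} L♯(T)` and `L♭(T^ι) = σ (1+T)^{c+b} L♭(T)`, `T^ι = (1+T)⁻¹ − 1`.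
This is the `p = 2`, `i = 0` case of Sprung's explicit functional equation of the non-completed
`L♯/L♭` for `a_p = 0` (Cor. 4.14: the units `W⁺ = ∏_{j≥1}(1+T)^{−2^{2j−1}} = (1+T)^{2/3}`,
`W⁻ = (1+T)^{−1}∏_{j≥2}(1+T)^{−2^{2j−2}} = (1+T)^{1/3}` at `p = 2`; signs as normalised in the
tree, `σ = −ε(f)`), obtained here not through the completed `L̂♯, L̂♭` but from the finite-level
functional equation of the Mazur–Tate elements `θ_n` (Mazur–Tate–Teitelbaum, §I.17 at finite
level: the symmetry `[−a/(2ⁿ⁺²N)]⁺ = −σ[a'/2ⁿ⁺²]⁺`, `a a' N ≡ 1`) transported under `T ↦ T^ι`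
(`isSprungPair_two_zero_transport`) and the uniqueness of the pair. The shift of the exponent by
`a = −2/3` (resp. `b = −1/3`) is the `ι`-weight `⌊2ⁿ/3⌋ → −2/3` (resp. `→ −1/3`) of the
chromatic polynomials `u_n` (odd `n`) and `v_n` (even `n`).
[cite: Sprung2017, Cor. 4.14 and §3.5 (functional equation, `a_p = 0`), Thm. 1.12, Cor. 4.4 (the pair)]
[cite: MazurTateTeitelbaum1986Invent, §I.13 (Mazur–Tate elements) and §I.17 (functional equation)]
[cite: GreenbergLNM1716, §1 (pp. 67–68: `L_p(E, T^ι) = w ⟨N⟩ L_p(E,T)`)] -/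
theorem subst_invOnePlusSubOne_eq_of_isSprungPair_two (hf : IsNewformOf W f)
    (hgood : W.HasGoodReductionAtPrime 2) (ha0 : W.frobeniusTrace 2 = 0) {σ : ℤ} (hσ : σ ^ 2 = 1)
    (hW : IsFrickeEigen N f (-(σ : ℂ))) {ηN : rootsOfUnity (torsionOrder 2) ℤ_[2]} {c : ℤ_[2]}
    (hc : ∀ n : ℕ, PadicInt.toZModPow (n + cyclotomicExponent 2) ((ηN : ℤ_[2]ˣ) : ℤ_[2]) *
      (cyclotomicGenerator 2 : ZMod (2 ^ (n + cyclotomicExponent 2))) ^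
        (PadicInt.toZModPow n c).val = (N : ZMod (2 ^ (n + cyclotomicExponent 2))))
    {a b : ℤ_[2]} (ha : 3 * a = -2) (hb : 3 * b = -1) {Ls Lf : IwasawaAlgebra 2}
    (h : IsSprungPair f 2 0 Ls Lf) :
    Ls.subst (invOnePlusSubOne : ℤ_[2]⟦X⟧) =
        (σ : IwasawaAlgebra 2) * PowerSeries.binomialSeries ℤ_[2] (c + a) * Ls ∧
      Lf.subst (invOnePlusSubOne : ℤ_[2]⟦X⟧) =
        (σ : IwasawaAlgebra 2) * PowerSeries.binomialSeries ℤ_[2] (c + b) * Lf := by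
  have hap : cuspCoeff f 2 = ((0 : ℤ) : ℂ) := by
    rw [cuspCoeff_eq_frobeniusTrace_of_isNewformOf_holds hf hgood, ha0]
  have h' := isSprungPair_two_zero_transport hf.1 hf.coeffField_eq_bot
    (not_dvd_level_of_isNewformOf hf hgood) hap hσ hW hc ha hb h
  obtain ⟨hs, hf'⟩ := IsSprungPair.unique (dvd_zero 2) h h'
  exact ⟨subst_invOnePlusSubOne_eq_of_eq_mul_subst hσ hs,
    subst_invOnePlusSubOne_eq_of_eq_mul_subst hσ hf'⟩

/-- **The functional equations of `L♯₂, L♭₂` (`a₂ = 0`) read in `ℚ₂⟦T⟧`**, in the shape used by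
the parity arguments (`norm_natCast_sub_le_of_subst_invOnePlusSubOne_eq`): with the notation of
`subst_invOnePlusSubOne_eq_of_isSprungPair_two`,
`(ι_Λ L♯)(T^ι) = C σ · (1+T)^{c+a} · ι_Λ L♯` and `(ι_Λ L♭)(T^ι) = C σ · (1+T)^{c+b} · ι_Λ L♭`.
[cite: Sprung2017, Cor. 4.14, Thm. 1.12] [cite: MazurTateTeitelbaum1986Invent, §I.17]
[cite: GreenbergLNM1716, §1 (pp. 67–68)] -/
theorem subst_iwasawaToPowerSeries_eq_of_isSprungPair_two (hf : IsNewformOf W f)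
    (hgood : W.HasGoodReductionAtPrime 2) (ha0 : W.frobeniusTrace 2 = 0) {σ : ℤ} (hσ : σ ^ 2 = 1)
    (hW : IsFrickeEigen N f (-(σ : ℂ))) {ηN : rootsOfUnity (torsionOrder 2) ℤ_[2]} {c : ℤ_[2]}
    (hc : ∀ n : ℕ, PadicInt.toZModPow (n + cyclotomicExponent 2) ((ηN : ℤ_[2]ˣ) : ℤ_[2]) *
      (cyclotomicGenerator 2 : ZMod (2 ^ (n + cyclotomicExponent 2))) ^
        (PadicInt.toZModPow n c).val = (N : ZMod (2 ^ (n + cyclotomicExponent 2))))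
    {a b : ℤ_[2]} (ha : 3 * a = -2) (hb : 3 * b = -1) {Ls Lf : IwasawaAlgebra 2}
    (h : IsSprungPair f 2 0 Ls Lf) :
    (iwasawaToPowerSeries 2 Ls).subst (invOnePlusSubOne : ℚ_[2]⟦X⟧) =
        C ((σ : ℤ) : ℚ_[2]) * PowerSeries.binomialSeries ℚ_[2] (c + a) *
          iwasawaToPowerSeries 2 Ls ∧
      (iwasawaToPowerSeries 2 Lf).subst (invOnePlusSubOne : ℚ_[2]⟦X⟧) =
        C ((σ : ℤ) : ℚ_[2]) * PowerSeries.binomialSeries ℚ_[2] (c + b) *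
          iwasawaToPowerSeries 2 Lf := by
  obtain ⟨hs, hf'⟩ := subst_invOnePlusSubOne_eq_of_isSprungPair_two hf hgood ha0 hσ hW hc ha hb h
  exact ⟨subst_iwasawaToPowerSeries_eq_of_subst_eq hs, subst_iwasawaToPowerSeries_eq_of_subst_eq hf'⟩

/-- **Existence form, any level**: for `f ∈ S₂(Γ₀(N))` the newform of `W` (good supersingular at
`2`, `a₂ = 0`) there are a sign `σ = ±1` with `σ = −ε(f)` (`ε(f)` the Atkin–Lehner eigenvalue),
a `2`-adic exponent `c` of `⟨N⟩` (`N ≡ η_N 5^c`), and `a, b ∈ ℤ₂` with `3a = −2`, `3b = −1`, such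
that Sprung's pair satisfies `L♯(T^ι) = σ(1+T)^{c+a}L♯`, `L♭(T^ι) = σ(1+T)^{c+b}L♭`.
[cite: Sprung2017, Cor. 4.14, Thm. 1.12] [cite: MazurTateTeitelbaum1986Invent, §I.17]
[cite: GreenbergLNM1716, §1 (pp. 67–68) and §5 (p. 181)] -/
theorem exists_functionalEquation_sharp_flat_two (hf : IsNewformOf W f)
    (hgood : W.HasGoodReductionAtPrime 2) (ha0 : W.frobeniusTrace 2 = 0) :
    ∃ σ : ℤ, (σ = 1 ∨ σ = -1) ∧ (σ : ℂ) = -frickeEigenvalue f ∧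
      ∃ (ηN : rootsOfUnity (torsionOrder 2) ℤ_[2]) (c a b : ℤ_[2]),
        (∀ n : ℕ, PadicInt.toZModPow (n + cyclotomicExponent 2) ((ηN : ℤ_[2]ˣ) : ℤ_[2]) *
          (cyclotomicGenerator 2 : ZMod (2 ^ (n + cyclotomicExponent 2))) ^
            (PadicInt.toZModPow n c).val = (N : ZMod (2 ^ (n + cyclotomicExponent 2)))) ∧
        3 * a = -2 ∧ 3 * b = -1 ∧
        ∀ Ls Lf : IwasawaAlgebra 2, IsSprungPair f 2 0 Ls Lf →
          Ls.subst (invOnePlusSubOne : ℤ_[2]⟦X⟧) =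
              (σ : IwasawaAlgebra 2) * PowerSeries.binomialSeries ℤ_[2] (c + a) * Ls ∧
            Lf.subst (invOnePlusSubOne : ℤ_[2]⟦X⟧) =
              (σ : IwasawaAlgebra 2) * PowerSeries.binomialSeries ℤ_[2] (c + b) * Lf := by
  have hsm := IsNewform0.frickeInvolution_eq_smul_holds (N := N) (k := (2 : ℤ)) hf.1
  have hFE : IsFrickeEigen N f (frickeEigenvalue f) :=
    isFrickeEigen_of_frickeInvolution_eq_smul N hsm
  obtain ⟨ηN, c, hc⟩ := exists_teichmuller_exponent_natCast 2 (not_dvd_level_of_isNewformOf hf hgood)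
  obtain ⟨a, ha⟩ := exists_three_mul_eq (-2)
  obtain ⟨b, hb⟩ := exists_three_mul_eq (-1)
  rcases IsNewform0.frickeEigenvalue_eq_one_or_eq_neg_one_holds (N := N) (k := (2 : ℤ)) hf.1 with
    h1 | h1
  · have hW : IsFrickeEigen N f (-((-1 : ℤ) : ℂ)) := by
      have : (-((-1 : ℤ) : ℂ)) = frickeEigenvalue f := by rw [h1]; push_cast; ring
      rw [this]; exact hFE
    exact ⟨-1, Or.inr rfl, by rw [h1]; push_cast; ring, ηN, c, a, b, hc, ha, hb, fun Ls Lf h ↦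
      subst_invOnePlusSubOne_eq_of_isSprungPair_two hf hgood ha0 (by norm_num) hW hc ha hb h⟩
  · have hW : IsFrickeEigen N f (-((1 : ℤ) : ℂ)) := by
      have : (-((1 : ℤ) : ℂ)) = frickeEigenvalue f := by rw [h1]; push_cast; ring
      rw [this]; exact hFE
    exact ⟨1, Or.inl rfl, by rw [h1]; push_cast; ring, ηN, c, a, b, hc, ha, hb, fun Ls Lf h ↦
      subst_invOnePlusSubOne_eq_of_isSprungPair_two hf hgood ha0 (by norm_num) hW hc ha hb h⟩

end FunctionalEquation

section ConductorLevel

variable {W : WeierstrassCurve ℚ} [W.IsElliptic] [W.IsGloballyMinimal] [NeZero (W.conductorNorm ℤ)]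
  {f : CuspForm (Gamma0 (W.conductorNorm ℤ)) 2}

/-- **At the conductor level the sign is the root number**: for `f ∈ S₂(Γ₀(N_W))` the newform of
`W` (good supersingular at `2`, `a₂ = 0`), `N_W = η 5^c`, `3a = −2`, `3b = −1`, Sprung's pair
satisfies `L♯(T^ι) = w_E (1+T)^{c+a} L♯` and `L♭(T^ι) = w_E (1+T)^{c+b} L♭`, `w_E = W.rootNumber`
(`w_E = −ε(f)`: `rootNumber_eq_neg_frickeEigenvalue`). Greenberg: "The 'signs' in the functional
equations for `L_p(E/ℚ, s)` and `L(E/ℚ, s)` are the same."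
[cite: Sprung2017, Cor. 4.14, Thm. 1.12] [cite: GreenbergLNM1716, §1 (pp. 67–68)]
[cite: MazurTateTeitelbaum1986Invent, §I.17] -/
theorem subst_invOnePlusSubOne_eq_rootNumber_of_isSprungPair_two (hf : IsNewformOf W f)
    (hgood : W.HasGoodReductionAtPrime 2) (ha0 : W.frobeniusTrace 2 = 0)
    {ηN : rootsOfUnity (torsionOrder 2) ℤ_[2]} {c : ℤ_[2]}
    (hc : ∀ n : ℕ, PadicInt.toZModPow (n + cyclotomicExponent 2) ((ηN : ℤ_[2]ˣ) : ℤ_[2]) *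
      (cyclotomicGenerator 2 : ZMod (2 ^ (n + cyclotomicExponent 2))) ^
        (PadicInt.toZModPow n c).val =
          (W.conductorNorm ℤ : ZMod (2 ^ (n + cyclotomicExponent 2))))
    {a b : ℤ_[2]} (ha : 3 * a = -2) (hb : 3 * b = -1) {Ls Lf : IwasawaAlgebra 2}
    (h : IsSprungPair f 2 0 Ls Lf) :
    Ls.subst (invOnePlusSubOne : ℤ_[2]⟦X⟧) =
        (W.rootNumber : IwasawaAlgebra 2) * PowerSeries.binomialSeries ℤ_[2] (c + a) * Ls ∧
      Lf.subst (invOnePlusSubOne : ℤ_[2]⟦X⟧) =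
        (W.rootNumber : IwasawaAlgebra 2) * PowerSeries.binomialSeries ℤ_[2] (c + b) * Lf := by
  have hw : (W.rootNumber : ℂ) = -frickeEigenvalue f :=
    rootNumber_eq_neg_frickeEigenvalue (fun _ _ ↦ IsNewform0.exists_functional_equation_holds)
      (fun _ _ ↦ IsNewform0.frickeEigenvalue_eq_one_or_eq_neg_one_holds) hf
  have hsm := IsNewform0.frickeInvolution_eq_smul_holds (N := W.conductorNorm ℤ) (k := (2 : ℤ)) hf.1
  have hFE : IsFrickeEigen (W.conductorNorm ℤ) f (frickeEigenvalue f) :=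
    isFrickeEigen_of_frickeInvolution_eq_smul _ hsm
  have hW : IsFrickeEigen (W.conductorNorm ℤ) f (-((W.rootNumber : ℤ) : ℂ)) := by
    rw [hw, neg_neg]; exact hFE
  have hσ : W.rootNumber ^ 2 = 1 := by
    rcases W.rootNumber_eq_one_or with h | h <;> rw [h] <;> norm_num
  exact subst_invOnePlusSubOne_eq_of_isSprungPair_two hf hgood ha0 hσ hW hc ha hb h

end ConductorLevel

end Literature.Barriers.BirchSwinnertonDyer

end
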